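/-
Copyright (c) 2026 the pub-hodgecm-mathlib formalisation cell (harness21).  Prover seat hodgecm-mathlib-K2E3-p21 (g5), Track B «K2-LIT» ∕ h413
(`stmt-HodgeConjecture-24833`), line `K2_E3_EllipticInputs`, unit U12 §L, road «GL-[M6]-sc» (line lead K2E3-p23 (g5), RULINGS #5 (M5-4) ∕ #7 (M7-1) ∕ #8 (M8-2)),
brick B4-J, FILE 3 of 3: «HARISH-CHANDRA'S CRITERION AT `G_Λ = GL₃(F) ⧸ Λ·1` AND THE CUSP-FORM PROPERTY OF SUPERCUSPIDAL COEFFICIENTS ALONG THE UNIPOTENT RADICALS».  2026-09-04.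
-/
import Summits.HodgeConjecture.HodgeConjecture.Theorems.K2E3GLnUnipotentExhaustion          -- ★ FILE 2 (this seat): `N_j` for `U_c`, `N̄_c`; compact support along `U`; brings ★ FILE 1, ★ B2 `…ModCocompactFrame`
import Summits.HodgeConjecture.HodgeConjecture.Theorems.K2E3GL3SupercuspidalTwistDescent      -- ★ B0c-1 p857846 (this seat, g4): `isSmoothVector_iff_of_comp_mk`
import Summits.HodgeConjecture.HodgeConjecture.Theorems.K2E1SupercuspidalCoefficientNCuspidal -- ★ p855253-line generic heads `integral_dual_apply_translate_eq_zero`, `integral_sesqForm_*`; brings ★ `ParabolicInductionSupercuspidalProofs`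
import HarnessLib

/-!
# K2_E3 road (h413), road «GL-[M6]-sc», brick B4-J (file 3): Harish-Chandra's criterion ⇒ for `GL_n(F)` and for `G_Λ = GL₃(F) ⧸ Λ·1`, and the CUSP-FORM PROPERTY
# `∫_N θ(x n y) dn = 0` of the coefficients of a smooth supercuspidal representation along the unipotent radicals `N = U_c` (B, P_{2,1}, P_{1,2}) and `N̄_c = π_Λ(U_c)`

Cell `pub/hodgecm-mathlib` (D-0151), Track B, seat K2E3-p21 (g5); line lead K2E3-p23 (g5): RULINGS #7 (M7-1) «target shape = the `hcusp` input of ★ `CuspFormCancellationCore`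
for GL₃: `∀ x y, ∫ n : ↥N, θ̃ (x * n * y) ∂ν = 0` for the unipotent radicals `N` of B, P_{2,1}, P_{1,2} and `θ̃` a matrix coefficient of a supercuspidal irreducible smooth
`r` of GL₃(F)»; RULINGS #8 (M8-2) «B4-J = PACKAGING AT `G_Λ` … the `N̄_c := (unipotentRadicalGL F c).map π_Λ` heads «=»; file it»; dealer K2E3-plan (g3).  `--supports
stmt-HodgeConjecture-24833 --as helper`; THEOREMS ONLY (no definition ∕ instance ∕ notation ∕ named-fact hypothesis ∕ `sorry`).

THE MATHEMATICS [HarishChandra1970, Part I §3 p. 9 (supercusp forms; coefficients of supercuspidal representations are supercusp forms), Part VII §3 p. 70 (`N ⊂ G ⧸ Z`)];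
[Casselman1995, Thm. 5.3.1 (a)⇒(c), Prop. 1.4.4]; [BernsteinZelevinsky1976, Thm. 3.21, §2.33]; [Rogawski1990, §12.2 p. 173]; [Gelbart1975, Remark 9.23].  HARISH-CHANDRA'S
CRITERION ⇒ for `GL_n(F)` IS ★ ALREADY (`coinvariantsKer_eq_top_of_isSupercuspidal`, `ParabolicInductionSupercuspidalProofs`: smooth supercuspidal ⇒ `V = V(U_c)` for
every two-block proper `c`; general proper `c` by first-block coarsening, no irreducibility needed); this file PACKAGES it:
* §1 GENERIC pull-back along `G → G ⧸ N₀`: `isSmooth_comp_mk'_iff`, `mem_contragredient_comp_mk'_iff`, **`isSupercuspidal_comp_mk'`** (if `N₀ ≤ Z(G)` and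
  `Z(G ⧸ N₀) = π(Z(G))`, a supercuspidal `ρ'` of `G ⧸ N₀` pulls back to a supercuspidal `ρ' ∘ π` of `G`: lift the compact `C'` through the open quotient map ★
  `exists_isCompact_subset_image_mk`), `subsingleton_coinvariants_comp_map_iff` (the `N̄ = π(U)`- and `U`-coinvariants of `ρ'`, `ρ' ∘ π` coincide).
* §2 `GL_n(F)`: **`coinvariants_subsingleton_restrictUnipotentGL_of_isSupercuspidal`** (any proper `c : Fin n → Fin r`), the `π.comp U_c.subtype` reading and the span
  currency `hJ`; the CUSP-FORM HEADS **`integral_dual_apply_translate_unipotentRadicalGL_eq_zero`** ∕ **`integral_sesqForm_apply_translate_unipotentRadicalGL_eq_zero`**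
  ∕ `…_translate_apply_…`: for `π` smooth supercuspidal, `μ` right-invariant finite on compacta on `↥U_c` (every Haar measure, ★ FILE 2), `φ ∈ π̃` (resp. `B`
  `π`-invariant sesquilinear), ALL `x y`: `∫_{U_c} φ(π(x u y) v) dμ(u) = 0` — convergence by ★ FILE 2 `hasCompactSupport_comp_translate_of_support_subset_mul_center`
  (the centre of `GL_n(F)` is not compact, but `U_c ∩ C·Z` is).  This is (M7-1)'s shape VERBATIM at `GL₃(F)` for B = `U_{id}`, P_{2,1}, P_{1,2}.
* §3 `G_Λ = GL₃(F) ⧸ Λ·1` (`[CharZero F]`; ★ B2 `center_quotScalar_eq`, ★ B0a `map_scalar_le_center`): **`isSupercuspidal_comp_mk'_quotScalar`** (supercuspidal on `G_Λ` ⇒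
  supercuspidal on `GL₃(F)`), **`coinvariants_subsingleton_map_unipotentRadicalGL_of_isSupercuspidal`** (Jacquet vanishing along `N̄_c`) + span currency, and the heads AT
  `G_Λ` (`Λ₀` closed cocompact, `Z(G_Λ)` compact ★ B2): **`integral_dual_apply_translate_map_unipotentRadicalGL_eq_zero`**, **`integral_sesqForm_apply_translate_map_…`**,
  `integral_sesqForm_translate_apply_map_…` — the `hcusp`∕`hcuspbar`-type inputs of ★ `CuspFormCancellationCore` for `θ = B u' (ρ(·) u)` on `G_Λ` along `N̄_c`; and the
  PULL-BACK READING for the road's `θ̃ = θ ∘ π_Λ` on `GL₃(F)` along `U_c`: `integral_sesqForm_apply_translate_unipotentRadicalGL_comp_mk_eq_zero` (no cocompactness needed).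

HONEST LABEL: HC_CM is proved only modulo the 7 printed citations (2 remaining named inputs: hLiu418 = `stmt-HodgeConjecture-24832`, h413 = `stmt-HodgeConjecture-24833`)
until rung 0 closes; this file is a count-neutral helper and closes no socket.

## References
* [HarishChandra1970] Harish-Chandra (notes by G. van Dijk), *Harmonic Analysis on Reductive p-adic Groups*, LNM 162 (1970), Part I §3 p. 9; Part VII §3 p. 70.
* [Casselman1995] W. Casselman, *Introduction to the theory of admissible representations of `p`-adic reductive groups* (1995 notes), Prop. 1.4.4, Thm. 5.3.1.
* [BernsteinZelevinsky1976] I. N. Bernstein, A. V. Zelevinsky, *Representations of the group GL(n, F) where F is a non-archimedean local field*, Russian Math.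
  Surveys 31:3 (1976), §2.33, Thm. 3.21.
* [Rogawski1990] J. D. Rogawski, *Automorphic Representations of Unitary Groups in Three Variables*, Ann. of Math. Stud. 123 (1990), §12.2 p. 173.
* [Gelbart1975] S. Gelbart, *Automorphic forms on adele groups*, Ann. of Math. Stud. 83 (1975), Remark 9.23 p. 140.
* [BushnellHenniart2006] C. J. Bushnell, G. Henniart, *The Local Langlands Conjecture for GL(2)*, Grundlehren 335 (2006), §§1.1, 2.8, 10.1.
-/

set_option autoImplicit false
-- the mandated namespace repeats the single-problem summit's segment (`HodgeConjecture.HodgeConjecture`)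
set_option linter.dupNamespace false

noncomputable section

open Set Filter Topology MeasureTheory
open scoped MatrixGroups Pointwise ComplexConjugate
open Literature.NumberTheory.Automorphic Literature.NumberTheory.GaloisRepresentations Literature.NumberTheory.GaloisRepresentations.IsNonarchimedeanLocalField
open Summit.HodgeConjecture.HodgeConjecture.Cruxes.H413.K2E3GLnUnipotentModScalars
open Summit.HodgeConjecture.HodgeConjecture.Cruxes.H413.K2E3GLnUnipotentExhaustion
open Summit.HodgeConjecture.HodgeConjecture.Cruxes.H413.K2E3GL3SupercuspidalTwistDescent (isSmoothVector_iff_of_comp_mk)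
open Summit.HodgeConjecture.HodgeConjecture.Cruxes.H413.K2E1SupercuspidalCoefficientNCuspidal

namespace Summit.HodgeConjecture.HodgeConjecture.Cruxes.H413.K2E3GL3SupercuspidalJacquetVanishing

/-! ## §1  Generic: pulling a representation of `G ⧸ N₀` back to `G` -/

section PullBack

variable {k : Type*} [Field k] {G : Type*} [Group G] [TopologicalSpace G] [IsTopologicalGroup G]
  {V : Type*} [AddCommGroup V] [Module k V] (N₀ : Subgroup G) [N₀.Normal] (ρ' : Representation k (G ⧸ N₀) V)

/-- **`ρ' ∘ π` is smooth iff `ρ'` is** (same stabilisers up to the open quotient map; ★ B0c-1 `isSmoothVector_iff_of_comp_mk`). [cite: BushnellHenniart2006, §1.1] -/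
theorem isSmooth_comp_mk'_iff : Representation.IsSmooth (ρ'.comp (QuotientGroup.mk' N₀)) ↔ ρ'.IsSmooth :=
  ⟨fun h v => (isSmoothVector_iff_of_comp_mk N₀ (ρ'.comp (QuotientGroup.mk' N₀)) ρ' (fun _ => rfl) v).2 (h v),
    fun h v => (isSmoothVector_iff_of_comp_mk N₀ (ρ'.comp (QuotientGroup.mk' N₀)) ρ' (fun _ => rfl) v).1 (h v)⟩

/-- **Same smooth contragredient** for `ρ'` and `ρ' ∘ π`. [cite: BushnellHenniart2006, §2.8] -/
theorem mem_contragredient_comp_mk'_iff (φ : Module.Dual k V) :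
    φ ∈ Representation.contragredient (ρ'.comp (QuotientGroup.mk' N₀)) ↔ φ ∈ ρ'.contragredient := by
  rw [Representation.mem_contragredient, Representation.mem_contragredient]
  refine (isSmoothVector_iff_of_comp_mk N₀ (Representation.dual (ρ'.comp (QuotientGroup.mk' N₀))) ρ'.dual (fun g => ?_) φ).symm
  rw [Representation.dual_apply, Representation.dual_apply, ← QuotientGroup.mk_inv]
  rfl

/-- **SUPERCUSPIDALITY PULLS BACK ALONG `π : G → G ⧸ N₀`** when `N₀ ≤ Z(G)` and `Z(G ⧸ N₀) = π(Z(G))` (`G` locally compact): a coefficient of `ρ' ∘ π` is a coefficient of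
`ρ'` composed with `π`, its support lies in `π⁻¹(C' · Z(G ⧸ N₀)) ⊆ C · Z(G)` for a compact `C ⊆ G` with `C' ⊆ π(C)` (★ `exists_isCompact_subset_image_mk`).
[cite: HarishChandra1970, Part I §3 p. 9] [cite: Casselman1995, Thm. 5.3.1] -/
theorem isSupercuspidal_comp_mk' [LocallyCompactSpace G] (hN₀ : N₀ ≤ Subgroup.center G)
    (hZ : Subgroup.center (G ⧸ N₀) ≤ (Subgroup.center G).map (QuotientGroup.mk' N₀)) (h : ρ'.IsSupercuspidal) :
    Representation.IsSupercuspidal (ρ'.comp (QuotientGroup.mk' N₀)) := by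
  intro φ hφ v
  obtain ⟨C', hC', hsupp⟩ := h φ ((mem_contragredient_comp_mk'_iff N₀ ρ' φ).1 hφ) v
  obtain ⟨C, hC, hCC'⟩ := exists_isCompact_subset_image_mk N₀ hC'
  refine ⟨C, hC, fun g hg => ?_⟩
  have hg' : (QuotientGroup.mk g : G ⧸ N₀) ∈ Function.support (ρ'.matrixCoeff φ v) := hg
  obtain ⟨x', hx', z', hz', hxz⟩ := Set.mem_mul.1 (hsupp hg')
  obtain ⟨x, hx, rfl⟩ := hCC' hx'
  obtain ⟨z, hz, hzz'⟩ := Subgroup.mem_map.1 (hZ hz')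
  have hmk : (QuotientGroup.mk (x * z) : G ⧸ N₀) = QuotientGroup.mk g := by
    rw [QuotientGroup.mk_mul, ← hxz, ← hzz']
    rfl
  have hn : (x * z)⁻¹ * g ∈ N₀ := QuotientGroup.eq.1 hmk
  exact Set.mem_mul.2 ⟨x, hx, z * ((x * z)⁻¹ * g), Subgroup.mul_mem _ hz (hN₀ hn), by group⟩

omit [TopologicalSpace G] [IsTopologicalGroup G] in
/-- **The `π(U)`-coinvariants of `ρ'` and the `U`-coinvariants of `ρ' ∘ π` are the same space** (same generators `ρ'(π u) w − w`). [cite: BernsteinZelevinsky1976, §2.33] -/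
theorem subsingleton_coinvariants_comp_map_iff (U : Subgroup G) :
    Subsingleton (Representation.Coinvariants (ρ'.comp (U.map (QuotientGroup.mk' N₀)).subtype)) ↔
      Subsingleton (Representation.Coinvariants ((ρ'.comp (QuotientGroup.mk' N₀)).comp U.subtype)) := by
  have hker : Representation.Coinvariants.ker (ρ'.comp (U.map (QuotientGroup.mk' N₀)).subtype) =
      Representation.Coinvariants.ker ((ρ'.comp (QuotientGroup.mk' N₀)).comp U.subtype) := by
    apply le_antisymm
    · refine Submodule.span_le.2 ?_
      rintro _ ⟨⟨p, w⟩, rfl⟩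
      obtain ⟨u, hu, hpu⟩ := Subgroup.mem_map.1 p.2
      refine Submodule.subset_span ⟨(⟨u, hu⟩, w), ?_⟩
      show ρ' (QuotientGroup.mk' N₀ u) w - w = ρ' (p : G ⧸ N₀) w - w
      rw [hpu]
    · refine Submodule.span_le.2 ?_
      rintro _ ⟨⟨q, w⟩, rfl⟩
      exact Submodule.subset_span ⟨(⟨QuotientGroup.mk' N₀ (q : G), Subgroup.mem_map_of_mem _ q.2⟩, w), rfl⟩
  change Subsingleton (V ⧸ _) ↔ Subsingleton (V ⧸ _)
  rw [Submodule.Quotient.subsingleton_iff, Submodule.Quotient.subsingleton_iff, hker]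

end PullBack

/-! ## §2  `GL_n(F)`: Jacquet vanishing for every proper standard parabolic, and the cusp-form property along `U_c` -/

section GLn

variable {F : Type*} [Field F] [ValuativeRel F] [TopologicalSpace F] [IsNonarchimedeanLocalField F] {n : ℕ}
  {V : Type*} [AddCommGroup V] [Module ℂ V] (π : Representation ℂ (GL (Fin n) F) V)

/-- **HARISH-CHANDRA'S CRITERION ⇒ FOR `GL_n(F)`, ANY PROPER STANDARD PARABOLIC**: for `π` smooth supercuspidal and `c : Fin n → Fin r` surjective with `r ≥ 2`
(★ `IsProperBlocks`), the Jacquet module `V ⧸ V(U_c)` vanishes (★ `coinvariantsKer_eq_top_of_isSupercuspidal` for the first-block coarsening + ★ `coinvariantsKer_mono`;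
no irreducibility, no monotonicity). [cite: Casselman1995, Thm. 5.3.1] [cite: BernsteinZelevinsky1976, Thm. 3.21] [cite: HarishChandra1970, Part I §3 p. 9] -/
theorem coinvariants_subsingleton_restrictUnipotentGL_of_isSupercuspidal (hπ : π.IsSmooth) (hsc : π.IsSupercuspidal) {r : ℕ} {c : Fin n → Fin r}
    (hc : IsProperBlocks c) : Subsingleton (Representation.restrictUnipotentGL F c π).Coinvariants := by
  change Subsingleton (V ⧸ _)
  rw [Submodule.Quotient.subsingleton_iff]
  have h2 := coinvariantsKer_eq_top_of_isSupercuspidal π hπ hsc (isProperBlocks_firstBlock hc)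
  exact eq_top_iff.2 (h2 ▸ coinvariantsKer_mono π (unipotentRadicalGL_firstBlock_le c))

/-- The same in the `π.comp U_c.subtype` currency of ★ `K2E1SupercuspidalUnipotentPeriodVanishing` (`U_c = map subtype U_c^P`: same generators).
[cite: Casselman1995, Thm. 5.3.1] [cite: BernsteinZelevinsky1976, Thm. 3.21] -/
theorem coinvariants_subsingleton_comp_unipotentRadicalGL_of_isSupercuspidal (hπ : π.IsSmooth) (hsc : π.IsSupercuspidal) {r : ℕ} {c : Fin n → Fin r}
    (hc : IsProperBlocks c) : Subsingleton (Representation.Coinvariants (π.comp (unipotentRadicalGL F c).subtype)) := by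
  have h := coinvariants_subsingleton_restrictUnipotentGL_of_isSupercuspidal π hπ hsc hc
  have hker : Representation.Coinvariants.ker (π.comp (unipotentRadicalGL F c).subtype) =
      Representation.Coinvariants.ker (Representation.restrictUnipotentGL F c π) := by
    apply le_antisymm
    · refine Submodule.span_le.2 ?_
      rintro _ ⟨⟨p, w⟩, rfl⟩
      obtain ⟨q, hq, hqp⟩ := Subgroup.mem_map.1 p.2
      refine Submodule.subset_span ⟨(⟨q, hq⟩, w), ?_⟩
      show π ((standardParabolicGL F c).subtype q) w - w = π (p : GL (Fin n) F) w - w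
      rw [hqp]
    · refine Submodule.span_le.2 ?_
      rintro _ ⟨⟨q, w⟩, rfl⟩
      exact Submodule.subset_span ⟨(⟨(q : ↥(standardParabolicGL F c)), Subgroup.mem_map_of_mem _ q.2⟩, w), rfl⟩
  change Subsingleton (V ⧸ _) at h
  change Subsingleton (V ⧸ _)
  rw [Submodule.Quotient.subsingleton_iff] at h ⊢
  rw [hker, h]

/-- **`V = V(U_c)`** — the span currency `hJ` of ★ `K2E1SupercuspidalCoefficientNCuspidal` ∕ ★ `K2E1SupercuspidalUnipotentPeriodVanishing` for a smooth supercuspidal `π` of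
`GL_n(F)` and any proper `c`. [cite: Casselman1995, Thm. 5.3.1] [cite: BernsteinZelevinsky1976, Thm. 3.21] -/
theorem forall_mem_span_unipotentRadicalGL_of_isSupercuspidal (hπ : π.IsSmooth) (hsc : π.IsSupercuspidal) {r : ℕ} {c : Fin n → Fin r}
    (hc : IsProperBlocks c) (w : V) :
    w ∈ Submodule.span ℂ (Set.range fun p : ↥(unipotentRadicalGL F c) × V => π (p.1 : GL (Fin n) F) p.2 - p.2) := by
  haveI := coinvariants_subsingleton_comp_unipotentRadicalGL_of_isSupercuspidal π hπ hsc hc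
  have h0 : Representation.Coinvariants.mk (π.comp (unipotentRadicalGL F c).subtype) w = 0 := Subsingleton.elim _ _
  rw [Representation.Coinvariants.mk_eq_zero] at h0
  exact h0

variable [NeZero n] {r : ℕ} {c : Fin n → Fin r}
  [MeasurableSpace ↥(unipotentRadicalGL F c)] [BorelSpace ↥(unipotentRadicalGL F c)] (μ : Measure ↥(unipotentRadicalGL F c))

/-- **CUSP-FORM PROPERTY ALONG `U_c`, LINEAR SLOT — `∫_{U_c} φ(π(x u y) v) dμ(u) = 0` FOR ALL `x, y ∈ GL_n(F)`**, for `π` smooth SUPERCUSPIDAL, `φ ∈ π̃` smooth, `c` proper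
monotone, `μ` right-invariant and finite on compacta (every Haar measure of `U_c`, ★ FILE 2).  The integrand is locally constant with COMPACT support (★ FILE 2
`hasCompactSupport_comp_translate_of_support_subset_mul_center`), `V = V(U_c)` (§2) and `U_c = ⋃ N_j` (★ FILE 2), so ★ `integral_dual_apply_translate_eq_zero` applies.
[cite: HarishChandra1970, Part I §3 p. 9] [cite: Casselman1995, Thm. 5.3.1] [cite: Gelbart1975, Remark 9.23] -/
theorem integral_dual_apply_translate_unipotentRadicalGL_eq_zero (hπ : π.IsSmooth) (hsc : π.IsSupercuspidal) (hc : IsProperBlocks c) (hcm : Monotone c)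
    [IsFiniteMeasureOnCompacts μ] [μ.IsMulRightInvariant] {φ : Module.Dual ℂ V} (hφ : φ ∈ π.contragredient) (v : V) (x y : GL (Fin n) F) :
    ∫ u, φ (π (x * (u : GL (Fin n) F) * y) v) ∂μ = 0 := by
  haveI : T2Space F := (isLocalField F).toT2Space
  obtain ⟨Nj, hmono, hcpt, ho, hex⟩ := exists_compactOpen_subgroups_unipotentRadicalGL (F := F) c hcm
  obtain ⟨C, hC, hsupp⟩ := hsc φ hφ v
  have hcs : HasCompactSupport fun u : ↥(unipotentRadicalGL F c) => φ (π (x * (u : GL (Fin n) F) * y) v) :=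
    hasCompactSupport_comp_translate_of_support_subset_mul_center (unipotentRadicalGL_le_upperUnitriangular c hcm) (isClosed_unipotentRadicalGL c)
      (θ := π.matrixCoeff φ v) hC hsupp x y
  have hcont : Continuous fun u : ↥(unipotentRadicalGL F c) => φ (π (x * (u : GL (Fin n) F) * y) v) := by
    refine (isLocallyConstant_dual_apply_mul_subgroup π (unipotentRadicalGL F c) hπ φ x (π y v)).continuous.congr fun u => ?_
    rw [← Module.End.mul_apply, ← map_mul]
  exact integral_dual_apply_translate_eq_zero π (unipotentRadicalGL F c) μ hπ (forall_mem_span_unipotentRadicalGL_of_isSupercuspidal π hπ hsc hc)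
    Nj hmono hcpt ho hex φ x y v (hcont.integrable_of_hasCompactSupport hcs)

variable {B : V →ₗ⋆[ℂ] V →ₗ[ℂ] ℂ}

/-- **CUSP-FORM PROPERTY ALONG `U_c`, SESQUILINEAR CURRENCY (linear slot): `∫_{U_c} B u' (π(x u y) u) dμ = 0` for all `x y u u'`** (`B` `π`-invariant, so `B u' ∈ π̃` by ★
`sesqForm_apply_mem_contragredient`) — the `hcusp` input of ★ `CuspFormCancellationCore` ∕ B4-A1 ∕ B4-E1 for the coefficient `θ = B u' (π(·) u)` of a smooth supercuspidal
`π` of `GL₃(F)` along `N = U_c` (B: `c = id`, P_{2,1}, P_{1,2}), read at `(x, 1)` resp. with `y` absorbed. [cite: HarishChandra1970, Part I §3 p. 9] [cite: Casselman1995, Thm. 5.3.1] -/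
theorem integral_sesqForm_apply_translate_unipotentRadicalGL_eq_zero (hπ : π.IsSmooth) (hsc : π.IsSupercuspidal) (hc : IsProperBlocks c) (hcm : Monotone c)
    [IsFiniteMeasureOnCompacts μ] [μ.IsMulRightInvariant] (hBinv : ∀ (g : GL (Fin n) F) (v w : V), B (π g v) (π g w) = B v w)
    (x y : GL (Fin n) F) (u u' : V) :
    ∫ uu, B u' (π (x * (uu : GL (Fin n) F) * y) u) ∂μ = 0 :=
  integral_dual_apply_translate_unipotentRadicalGL_eq_zero π μ hπ hsc hc hcm (Representation.sesqForm_apply_mem_contragredient hπ B hBinv u') u x y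

/-- **Sesquilinear currency, conjugate-linear slot** (`B` Hermitian ★ `LinearMap.IsSymm`): `∫_{U_c} B (π(x u y) u) u' dμ = 0` (`integral_conj`). [cite: HarishChandra1970, Part I §3 p. 9] -/
theorem integral_sesqForm_translate_apply_unipotentRadicalGL_eq_zero (hπ : π.IsSmooth) (hsc : π.IsSupercuspidal) (hc : IsProperBlocks c) (hcm : Monotone c)
    [IsFiniteMeasureOnCompacts μ] [μ.IsMulRightInvariant] (hBsymm : B.IsSymm) (hBinv : ∀ (g : GL (Fin n) F) (v w : V), B (π g v) (π g w) = B v w)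
    (x y : GL (Fin n) F) (u u' : V) :
    ∫ uu, B (π (x * (uu : GL (Fin n) F) * y) u) u' ∂μ = 0 := by
  have heq : ∀ uu : ↥(unipotentRadicalGL F c), B (π (x * (uu : GL (Fin n) F) * y) u) u' = conj (B u' (π (x * (uu : GL (Fin n) F) * y) u)) := fun uu =>
    (hBsymm.eq u' (π (x * (uu : GL (Fin n) F) * y) u)).symm
  simp_rw [heq]
  rw [integral_conj, integral_sesqForm_apply_translate_unipotentRadicalGL_eq_zero π μ hπ hsc hc hcm hBinv x y u u', map_zero]

/-- **HAAR READING** (the consumer's binders): for ANY Haar measure `ν` on `↥U_c` (right-invariant by ★ FILE 2 `isMulRightInvariant_haar_unipotentRadicalGL`):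
`∀ x y u u', ∫_{U_c} B u' (π(x u y) u) dν = 0`. [cite: HarishChandra1970, Part I §3 p. 9] [cite: Casselman1995, Thm. 5.3.1] -/
theorem integral_sesqForm_apply_translate_unipotentRadicalGL_eq_zero_of_isHaarMeasure (hπ : π.IsSmooth) (hsc : π.IsSupercuspidal) (hc : IsProperBlocks c)
    (hcm : Monotone c) [μ.IsHaarMeasure] (hBinv : ∀ (g : GL (Fin n) F) (v w : V), B (π g v) (π g w) = B v w) (x y : GL (Fin n) F) (u u' : V) :
    ∫ uu, B u' (π (x * (uu : GL (Fin n) F) * y) u) ∂μ = 0 := by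
  haveI := isMulRightInvariant_haar_unipotentRadicalGL (F := F) c hcm μ
  exact integral_sesqForm_apply_translate_unipotentRadicalGL_eq_zero π μ hπ hsc hc hcm hBinv x y u u'

end GLn

/-! ## §3  `G_Λ = GL₃(F) ⧸ Λ·1`: Harish-Chandra's criterion and the cusp-form property along `N̄_c = π_Λ(U_c)` -/

section GL3ModScalars

variable {F : Type*} [Field F] [ValuativeRel F] [TopologicalSpace F] [IsNonarchimedeanLocalField F] [CharZero F] (Λ₀ : Subgroup Fˣ)
  [(Λ₀.map (Matrix.GeneralLinearGroup.scalar (Fin 3))).Normal] {V : Type*} [AddCommGroup V] [Module ℂ V]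
  (ρ : Representation ℂ (GL (Fin 3) F ⧸ Λ₀.map (Matrix.GeneralLinearGroup.scalar (Fin 3))) V)

/-- **SUPERCUSPIDAL ON `G_Λ` ⇒ SUPERCUSPIDAL ON `GL₃(F)`**: the pull-back `ρ ∘ π_Λ` of a supercuspidal representation of `G_Λ = GL₃(F) ⧸ Λ·1` is supercuspidal (§1 with
`Λ·1 ≤ Z` ★ B0a `map_scalar_le_center` and `Z(G_Λ) = π_Λ(Z(GL₃))` ★ B2 `center_quotScalar_eq`, characteristic `0`). [cite: HarishChandra1970, Part I §3 p. 9, Part VII §3 p. 70] -/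
theorem isSupercuspidal_comp_mk'_quotScalar (hsc : ρ.IsSupercuspidal) :
    Representation.IsSupercuspidal (ρ.comp (QuotientGroup.mk' (Λ₀.map (Matrix.GeneralLinearGroup.scalar (Fin 3))))) := by
  haveI := locallyCompactSpace_generalLinearGroup F (n := 3)
  exact isSupercuspidal_comp_mk' _ ρ (K2E3GLnUnipotentModScalars.map_scalar_le_center Λ₀) (K2E3GL3ModCocompactFrame.center_quotScalar_eq Λ₀).le hsc

variable {r : ℕ} {c : Fin 3 → Fin r}

/-- **JACQUET VANISHING AT `G_Λ` ALONG `N̄_c = π_Λ(U_c)`** for `ρ` smooth supercuspidal on `G_Λ` and any proper `c` (B, P_{2,1}, P_{1,2}): the `N̄_c`-coinvariants vanish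
(§1 transport + §2 for the supercuspidal pull-back `ρ ∘ π_Λ`). [cite: Casselman1995, Thm. 5.3.1] [cite: HarishChandra1970, Part VII §3 p. 70] [cite: Rogawski1990, §12.2 p. 173] -/
theorem coinvariants_subsingleton_map_unipotentRadicalGL_of_isSupercuspidal (hρ : ρ.IsSmooth) (hsc : ρ.IsSupercuspidal) (hc : IsProperBlocks c) :
    Subsingleton (Representation.Coinvariants
      (ρ.comp ((unipotentRadicalGL F c).map (QuotientGroup.mk' (Λ₀.map (Matrix.GeneralLinearGroup.scalar (Fin 3))))).subtype)) := by
  rw [subsingleton_coinvariants_comp_map_iff]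
  exact coinvariants_subsingleton_comp_unipotentRadicalGL_of_isSupercuspidal _
    ((isSmooth_comp_mk'_iff _ ρ).2 hρ) (isSupercuspidal_comp_mk'_quotScalar Λ₀ ρ hsc) hc

/-- **`V = V(N̄_c)`** — the span currency at `G_Λ`. [cite: Casselman1995, Thm. 5.3.1] [cite: BernsteinZelevinsky1976, Thm. 3.21] -/
theorem forall_mem_span_map_unipotentRadicalGL_of_isSupercuspidal (hρ : ρ.IsSmooth) (hsc : ρ.IsSupercuspidal) (hc : IsProperBlocks c) (w : V) :
    w ∈ Submodule.span ℂ (Set.range fun p : ↥((unipotentRadicalGL F c).map (QuotientGroup.mk' (Λ₀.map (Matrix.GeneralLinearGroup.scalar (Fin 3))))) × V =>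
      ρ (p.1 : GL (Fin 3) F ⧸ Λ₀.map (Matrix.GeneralLinearGroup.scalar (Fin 3))) p.2 - p.2) := by
  haveI := coinvariants_subsingleton_map_unipotentRadicalGL_of_isSupercuspidal Λ₀ ρ hρ hsc hc
  have h0 : Representation.Coinvariants.mk
      (ρ.comp ((unipotentRadicalGL F c).map (QuotientGroup.mk' (Λ₀.map (Matrix.GeneralLinearGroup.scalar (Fin 3))))).subtype) w = 0 := Subsingleton.elim _ _
  rw [Representation.Coinvariants.mk_eq_zero] at h0
  exact h0

variable [MeasurableSpace ↥((unipotentRadicalGL F c).map (QuotientGroup.mk' (Λ₀.map (Matrix.GeneralLinearGroup.scalar (Fin 3)))))]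
  [BorelSpace ↥((unipotentRadicalGL F c).map (QuotientGroup.mk' (Λ₀.map (Matrix.GeneralLinearGroup.scalar (Fin 3)))))]
  (μ : Measure ↥((unipotentRadicalGL F c).map (QuotientGroup.mk' (Λ₀.map (Matrix.GeneralLinearGroup.scalar (Fin 3))))))

/-- **CUSP-FORM PROPERTY AT `G_Λ`, LINEAR SLOT — `∫_{N̄_c} φ(ρ(x n y) v) dμ(n) = 0` FOR ALL `x, y ∈ G_Λ`** (`Λ₀` closed cocompact so `Z(G_Λ)` is compact ★ B2; `ρ` smooth supercuspidal;
`φ ∈ ρ̃`; `c` proper monotone; `μ` right-invariant finite on compacta, e.g. any Haar measure ★ FILE 2).  The coefficient is compactly supported on `G_Λ` (★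
`hasCompactSupport_matrixCoeff`), `N̄_c` is closed (★ FILE 1), `V = V(N̄_c)`, `N̄_c = ⋃ N_j` (★ FILE 2): ★ `integral_dual_apply_translate_eq_zero`.
[cite: HarishChandra1970, Part I §3 p. 9] [cite: Casselman1995, Thm. 5.3.1] -/
theorem integral_dual_apply_translate_map_unipotentRadicalGL_eq_zero [CompactSpace (Fˣ ⧸ Λ₀)] (hΛ : IsClosed (Λ₀ : Set Fˣ)) (hρ : ρ.IsSmooth) (hsc : ρ.IsSupercuspidal)
    (hc : IsProperBlocks c) (hcm : Monotone c) [IsFiniteMeasureOnCompacts μ] [μ.IsMulRightInvariant] {φ : Module.Dual ℂ V} (hφ : φ ∈ ρ.contragredient) (v : V)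
    (x y : GL (Fin 3) F ⧸ Λ₀.map (Matrix.GeneralLinearGroup.scalar (Fin 3))) :
    ∫ nn, φ (ρ (x * (nn : GL (Fin 3) F ⧸ Λ₀.map (Matrix.GeneralLinearGroup.scalar (Fin 3))) * y) v) ∂μ = 0 := by
  haveI : T2Space F := (isLocalField F).toT2Space
  haveI := K2E3GL3ModCocompactCentral.t2Space_quotScalar Λ₀ hΛ
  obtain ⟨Nj, hmono, hcpt, ho, hex⟩ := exists_compactOpen_subgroups_map_unipotentRadicalGL (F := F) c hcm Λ₀
  have hN := isClosed_coe_map_mk' (unipotentRadicalGL_le_upperUnitriangular c hcm) (isClosed_unipotentRadicalGL c) Λ₀ hΛ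
  have hcs : HasCompactSupport (ρ.matrixCoeff φ v) := hsc.hasCompactSupport_matrixCoeff (K2E3GL3ModCocompactFrame.isCompact_center_quotScalar Λ₀) hφ v
  have hcs' : HasCompactSupport fun nn : ↥((unipotentRadicalGL F c).map (QuotientGroup.mk' (Λ₀.map (Matrix.GeneralLinearGroup.scalar (Fin 3))))) =>
      φ (ρ (x * (nn : GL (Fin 3) F ⧸ Λ₀.map (Matrix.GeneralLinearGroup.scalar (Fin 3))) * y) v) := by
    have hG : HasCompactSupport fun g : GL (Fin 3) F ⧸ Λ₀.map (Matrix.GeneralLinearGroup.scalar (Fin 3)) => φ (ρ (x * g * y) v) := by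
      have heq : (fun g : GL (Fin 3) F ⧸ Λ₀.map (Matrix.GeneralLinearGroup.scalar (Fin 3)) => φ (ρ (x * g * y) v)) =
          ρ.matrixCoeff φ v ∘ ((Homeomorph.mulLeft x).trans (Homeomorph.mulRight y)) := by
        funext g
        simp only [Function.comp_apply, Homeomorph.trans_apply, Homeomorph.coe_mulLeft, Homeomorph.coe_mulRight, Representation.matrixCoeff_apply]
      rw [heq]
      exact hcs.comp_homeomorph _
    exact hG.comp_isClosedEmbedding hN.isClosedEmbedding_subtypeVal
  have hcont : Continuous fun nn : ↥((unipotentRadicalGL F c).map (QuotientGroup.mk' (Λ₀.map (Matrix.GeneralLinearGroup.scalar (Fin 3))))) =>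
      φ (ρ (x * (nn : GL (Fin 3) F ⧸ Λ₀.map (Matrix.GeneralLinearGroup.scalar (Fin 3))) * y) v) := by
    refine (isLocallyConstant_dual_apply_mul_subgroup ρ _ hρ φ x (ρ y v)).continuous.congr fun nn => ?_
    rw [← Module.End.mul_apply, ← map_mul]
  exact integral_dual_apply_translate_eq_zero ρ _ μ hρ (forall_mem_span_map_unipotentRadicalGL_of_isSupercuspidal Λ₀ ρ hρ hsc hc) Nj hmono hcpt ho hex φ x y v
    (hcont.integrable_of_hasCompactSupport hcs')

variable {B : V →ₗ⋆[ℂ] V →ₗ[ℂ] ℂ}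

/-- **CUSP-FORM PROPERTY AT `G_Λ`, SESQUILINEAR CURRENCY (linear slot) — the `hcusp`-type input of ★ `CuspFormCancellationCore` at `G_Λ` along `N̄_c`**: for `θ = B u' (ρ(·) u)`,
`B` `ρ`-invariant, `∀ x y u u', ∫_{N̄_c} B u' (ρ(x n y) u) dμ = 0` (★ `integral_sesqForm_apply_translate_eq_zero_of_isSupercuspidal` fed with `Z(G_Λ)` compact ★ B2, `N̄_c`
closed ★ FILE 1, `hJ` above, `N_j` ★ FILE 2). [cite: HarishChandra1970, Part I §3 p. 9] [cite: Casselman1995, Thm. 5.3.1] -/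
theorem integral_sesqForm_apply_translate_map_unipotentRadicalGL_eq_zero [CompactSpace (Fˣ ⧸ Λ₀)] (hΛ : IsClosed (Λ₀ : Set Fˣ)) (hρ : ρ.IsSmooth)
    (hsc : ρ.IsSupercuspidal) (hc : IsProperBlocks c) (hcm : Monotone c) [IsFiniteMeasureOnCompacts μ] [μ.IsMulRightInvariant]
    (hBinv : ∀ (g : GL (Fin 3) F ⧸ Λ₀.map (Matrix.GeneralLinearGroup.scalar (Fin 3))) (v w : V), B (ρ g v) (ρ g w) = B v w)
    (x y : GL (Fin 3) F ⧸ Λ₀.map (Matrix.GeneralLinearGroup.scalar (Fin 3))) (u u' : V) :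
    ∫ nn, B u' (ρ (x * (nn : GL (Fin 3) F ⧸ Λ₀.map (Matrix.GeneralLinearGroup.scalar (Fin 3))) * y) u) ∂μ = 0 := by
  haveI : T2Space F := (isLocalField F).toT2Space
  haveI := K2E3GL3ModCocompactCentral.t2Space_quotScalar Λ₀ hΛ
  obtain ⟨Nj, hmono, hcpt, ho, hex⟩ := exists_compactOpen_subgroups_map_unipotentRadicalGL (F := F) c hcm Λ₀
  exact integral_sesqForm_apply_translate_eq_zero_of_isSupercuspidal ρ _ μ hsc (K2E3GL3ModCocompactFrame.isCompact_center_quotScalar Λ₀) hρ hBinv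
    (isClosed_coe_map_mk' (unipotentRadicalGL_le_upperUnitriangular c hcm) (isClosed_unipotentRadicalGL c) Λ₀ hΛ)
    (forall_mem_span_map_unipotentRadicalGL_of_isSupercuspidal Λ₀ ρ hρ hsc hc) Nj hmono hcpt ho hex x y u u'

/-- **The conjugate-linear slot at `G_Λ`** (`B` Hermitian): `∀ x y u u', ∫_{N̄_c} B (ρ(x n y) u) u' dμ = 0`. [cite: HarishChandra1970, Part I §3 p. 9] -/
theorem integral_sesqForm_translate_apply_map_unipotentRadicalGL_eq_zero [CompactSpace (Fˣ ⧸ Λ₀)] (hΛ : IsClosed (Λ₀ : Set Fˣ)) (hρ : ρ.IsSmooth)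
    (hsc : ρ.IsSupercuspidal) (hc : IsProperBlocks c) (hcm : Monotone c) [IsFiniteMeasureOnCompacts μ] [μ.IsMulRightInvariant] (hBsymm : B.IsSymm)
    (hBinv : ∀ (g : GL (Fin 3) F ⧸ Λ₀.map (Matrix.GeneralLinearGroup.scalar (Fin 3))) (v w : V), B (ρ g v) (ρ g w) = B v w)
    (x y : GL (Fin 3) F ⧸ Λ₀.map (Matrix.GeneralLinearGroup.scalar (Fin 3))) (u u' : V) :
    ∫ nn, B (ρ (x * (nn : GL (Fin 3) F ⧸ Λ₀.map (Matrix.GeneralLinearGroup.scalar (Fin 3))) * y) u) u' ∂μ = 0 := by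
  haveI : T2Space F := (isLocalField F).toT2Space
  haveI := K2E3GL3ModCocompactCentral.t2Space_quotScalar Λ₀ hΛ
  obtain ⟨Nj, hmono, hcpt, ho, hex⟩ := exists_compactOpen_subgroups_map_unipotentRadicalGL (F := F) c hcm Λ₀
  exact integral_sesqForm_translate_apply_eq_zero_of_isSupercuspidal ρ _ μ hsc (K2E3GL3ModCocompactFrame.isCompact_center_quotScalar Λ₀) hρ hBsymm hBinv
    (isClosed_coe_map_mk' (unipotentRadicalGL_le_upperUnitriangular c hcm) (isClosed_unipotentRadicalGL c) Λ₀ hΛ)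
    (forall_mem_span_map_unipotentRadicalGL_of_isSupercuspidal Λ₀ ρ hρ hsc hc) Nj hmono hcpt ho hex x y u u'

/-- **HAAR READING AT `G_Λ`**: for ANY Haar measure `μ` on `↥N̄_c` (right-invariant ★ FILE 2), `∀ x y u u', ∫_{N̄_c} B u' (ρ(x n y) u) dμ = 0` — at `(x, 1)` literally the `hcusp`
of ★ `CuspFormCancellationCore` for `θ = B u' (ρ(·) u)`. [cite: HarishChandra1970, Part I §3 p. 9] [cite: Casselman1995, Thm. 5.3.1] -/
theorem integral_sesqForm_apply_translate_map_unipotentRadicalGL_eq_zero_of_isHaarMeasure [CompactSpace (Fˣ ⧸ Λ₀)] (hΛ : IsClosed (Λ₀ : Set Fˣ))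
    (hρ : ρ.IsSmooth) (hsc : ρ.IsSupercuspidal) (hc : IsProperBlocks c) (hcm : Monotone c) [μ.IsHaarMeasure]
    (hBinv : ∀ (g : GL (Fin 3) F ⧸ Λ₀.map (Matrix.GeneralLinearGroup.scalar (Fin 3))) (v w : V), B (ρ g v) (ρ g w) = B v w)
    (x y : GL (Fin 3) F ⧸ Λ₀.map (Matrix.GeneralLinearGroup.scalar (Fin 3))) (u u' : V) :
    ∫ nn, B u' (ρ (x * (nn : GL (Fin 3) F ⧸ Λ₀.map (Matrix.GeneralLinearGroup.scalar (Fin 3))) * y) u) ∂μ = 0 := by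
  haveI := isMulRightInvariant_haar_map_unipotentRadicalGL (F := F) c hcm Λ₀ μ
  exact integral_sesqForm_apply_translate_map_unipotentRadicalGL_eq_zero Λ₀ ρ μ hΛ hρ hsc hc hcm hBinv x y u u'

omit [MeasurableSpace ↥((unipotentRadicalGL F c).map (QuotientGroup.mk' (Λ₀.map (Matrix.GeneralLinearGroup.scalar (Fin 3)))))]
  [BorelSpace ↥((unipotentRadicalGL F c).map (QuotientGroup.mk' (Λ₀.map (Matrix.GeneralLinearGroup.scalar (Fin 3)))))] μ in
/-- **THE PULL-BACK READING ON `GL₃(F)` (the road's `θ̃ = θ ∘ π_Λ`, (M5-2))**: for `ρ` smooth supercuspidal on `G_Λ` (ANY `Λ₀`, no cocompactness), `B` `ρ`-invariant, every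
Haar measure `ν` on `↥U_c` and all `x y ∈ GL₃(F)`: `∫_{U_c} B u' (ρ(π_Λ(x u y)) u) dν(u) = 0` — §2 for the supercuspidal pull-back `ρ ∘ π_Λ`.
[cite: HarishChandra1970, Part I §3 p. 9, Part VII §3 p. 70] [cite: Casselman1995, Thm. 5.3.1] -/
theorem integral_sesqForm_apply_translate_unipotentRadicalGL_comp_mk_eq_zero (hρ : ρ.IsSmooth) (hsc : ρ.IsSupercuspidal) (hc : IsProperBlocks c) (hcm : Monotone c)
    [MeasurableSpace ↥(unipotentRadicalGL F c)] [BorelSpace ↥(unipotentRadicalGL F c)] (ν : Measure ↥(unipotentRadicalGL F c)) [ν.IsHaarMeasure]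
    (hBinv : ∀ (g : GL (Fin 3) F ⧸ Λ₀.map (Matrix.GeneralLinearGroup.scalar (Fin 3))) (v w : V), B (ρ g v) (ρ g w) = B v w)
    (x y : GL (Fin 3) F) (u u' : V) :
    ∫ uu, B u' (ρ (QuotientGroup.mk (x * (uu : GL (Fin 3) F) * y)) u) ∂ν = 0 :=
  integral_sesqForm_apply_translate_unipotentRadicalGL_eq_zero_of_isHaarMeasure (ρ.comp (QuotientGroup.mk' (Λ₀.map (Matrix.GeneralLinearGroup.scalar (Fin 3))))) ν
    ((isSmooth_comp_mk'_iff _ ρ).2 hρ) (isSupercuspidal_comp_mk'_quotScalar Λ₀ ρ hsc) hc hcm (fun _ v w => hBinv _ v w) x y u u'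

end GL3ModScalars

end Summit.HodgeConjecture.HodgeConjecture.Cruxes.H413.K2E3GL3SupercuspidalJacquetVanishing

end
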